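import Summits.QuantumFields.BalabanUV.T4Continuum.Support.ShellMeasureExpJacobianSUN

/-!
# `T4Continuum.ShellMeasureExpInjectiveSUN` — the exponential chart of `SU(N)` is INJECTIVE on every Hilbert–Schmidt
# ball of radius `S < π` (Lagrange interpolation of the principal logarithm on the joint spectrum)
# (cell `pub-balaban`, sub-cell `t4`, spine estimate NE7c (node U5b); ROUND-2 crew `t4-ne7c-formalise-*`, row S3
# «SM-L9 SU(N) chart» of `t4/b2b-balaban-t4-ne7c-p1/LEAVES-NE7c-P1.md` (trigger `t4/T4-NE7c-TRIGGER.json`, c5: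
# optional and last); seat `b2b-balaban-t4-ne7c-formalise-leaf-04`; v1.1 = v1 (p210206) + §3 appended (closed ∕
# measurable embedding on the window; v1 declarations byte-identical); file 6 of the row — ingredient (a) of the located
# input (CH)₁ of GAPS G-ne7cL04-1 («`exp` restricted to the ball is one-to-one»), the part that is finite-dimensional
# linear algebra; tree target `Summits/QuantumFields/BalabanUV/T4Continuum/Support/`; ADDITIVE — imports
# `ShellMeasureExpJacobianSUN` (the Hermitian generator `herm`, its unitary diagonalisation, the eigenvalue bound) and
# modifies nothing)

HONEST FRAMING.  Finite four-torus programme, rung (B)+1 only — NOT infinite volume, NOT a mass gap, NOT the Clay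
problem, NOT summit progress.  Nothing of [Balaban 1983–89] is mentioned or asserted; NE7c NOT proved and not touched
(spine PROVED 0/9).  [folklore] linear algebra, 0 sorry, 0 citations, no `def … : Prop`.  This file does NOT prove
(CH)₁ (the measure identity stays displayed in `ShellMeasureRealizedSUN`); it proves the set-theoretic part of its
ingredient (a): injectivity of the chart on the window — for `SU(2)` the tree records the same for the cube chart
(`T4CubeChartExp.exists_cubeChart_specialUnitaryTwo_exp`: `InjOn φ (cube n S)`).
HONEST DEPENDENCY: continuum YM on T⁴ ⇐ BetaPertH ∧ nine spine estimates (0/9 proved); BetaPertH ⇐ (D1) ∧ (D4) ∧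
CAP+tail; G-an2-4 gates asym, D1 and NE2/3/4.

THE POINTS.
* §1 POLYNOMIAL FUNCTIONAL CALCULUS on unitarily diagonalised matrices: `aeval (U·diag d·U*) p = U·diag(p ∘ d)·U*`
  (`aeval_conjDiag`) — polynomials of a matrix ARE functions of the matrix, whatever diagonalisation is used.
* §2 INJECTIVITY (`expPtSU_injOn`): if `‖v‖, ‖w‖ ≤ S < π` and `exp (genSU v) = exp (genSU w) =: g`, diagonalise
  `−i·genSU v = U·diag θ·U*`, `−i·genSU w = V·diag φ·V*` (`|θ_k|, |φ_l| ≤ S < π` by the eigenvalue bound of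
  `ShellMeasureExpJacobianSUN`); the Lagrange polynomial `p` interpolating the PRINCIPAL LOGARITHM on the finite set
  `{e^{iθ_k}} ∪ {e^{iφ_l}}` satisfies `p(e^{iθ_k}) = iθ_k`, `p(e^{iφ_l}) = iφ_l` (`Complex.log_exp`, `|·| < π`), hence
  `genSU v = U·diag(p(e^{iθ}))·U* = p(g) = V·diag(p(e^{iφ}))·V* = genSU w` by §1, and `v = w` since the coordinates are
  a linear isometry.  So `expPtSU`, `expChartSU g` and the block chart `expFibreChartSU Λ u₀` are one-to-one on the
  (product) ball of radius `S < π` (`expChartSU_injOn`, `expFibreChartSU_injOn`).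

WHAT THIS DOES NOT DO.  No continuity/measurability of the inverse, no measure identity; (CH)₁ for `N ≥ 3` stays a
displayed binder; NE7c NOT proved.
-/

noncomputable section

namespace Summit.QuantumFields.BalabanUV.T4Continuum.ShellMeasureExpInjectiveSUN

open Matrix Finset Set Polynomial
open Complex (I)
open Literature.MathematicalPhysics.QuantumFieldTheory.Balaban1983to89
open T4AdjointCovarianceUnitary (lieSU)
open ShellMeasureVandermondeSUN ShellMeasureExpChartSUN ShellMeasureExpJacobianSUN

variable {N : ℕ}

/-! ## §1 Polynomials of a unitarily diagonalised matrix -/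

section Aeval

variable (U : Matrix.unitaryGroup (Fin N) ℂ)

/-- `conjDiag U` is additive in the diagonal. [folklore] -/
theorem conjDiag_add (d e : Fin N → ℂ) : conjDiag U (d + e) = conjDiag U d + conjDiag U e := by
  unfold conjDiag
  rw [show diagonal (d + e) = diagonal d + diagonal e from (diagonal_add d e).symm, Matrix.mul_add, Matrix.add_mul]

/-- `conjDiag U 0 = 0`. [folklore] -/
theorem conjDiag_zero : conjDiag U (0 : Fin N → ℂ) = 0 := by
  unfold conjDiag
  rw [show (0 : Fin N → ℂ) = fun _ => 0 from rfl, diagonal_zero, Matrix.mul_zero, Matrix.zero_mul]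

/-- `conjDiag U` commutes with finite sums of diagonals. [folklore] -/
theorem conjDiag_sum {ι : Type*} (s : Finset ι) (d : ι → Fin N → ℂ) :
    conjDiag U (∑ i ∈ s, d i) = ∑ i ∈ s, conjDiag U (d i) := by
  classical
  induction s using Finset.induction_on with
  | empty => rw [sum_empty, sum_empty, conjDiag_zero]
  | insert a s ha ih => rw [sum_insert ha, sum_insert ha, conjDiag_add, ih]

/-- **POLYNOMIAL FUNCTIONAL CALCULUS**: `aeval (U·diag d·U*) p = U·diag(k ↦ p(d_k))·U*`. [folklore] -/
theorem aeval_conjDiag (d : Fin N → ℂ) (p : ℂ[X]) :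
    aeval (conjDiag U d) p = conjDiag U fun k => p.eval (d k) := by
  rw [aeval_eq_sum_range]
  simp_rw [conjDiag_pow, smul_conjDiag]
  rw [← conjDiag_sum]
  congr 1
  funext k
  rw [eval_eq_sum_range, Finset.sum_apply]
  refine sum_congr rfl fun i _ => ?_
  rw [Pi.smul_apply, Pi.pow_apply, smul_eq_mul]

end Aeval

/-! ## §2 Injectivity of the exponential chart on the ball of radius `S < π` -/

section Injective

variable {v : ChartSU N} {U : Matrix.unitaryGroup (Fin N) ℂ} {θ : Fin N → ℝ}

/-- under a diagonalisation of `H(v)`, the generator is `genSU v = U·diag(iθ)·U*`. [folklore] -/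
theorem genSU_eq_conjDiag (h : herm v = conjDiag U fun k => (θ k : ℂ)) :
    genSU v = conjDiag U fun k => (θ k : ℂ) * I := by
  rw [genSU_eq_I_smul_herm, h, smul_conjDiag]
  congr 1
  funext k
  rw [Pi.smul_apply, smul_eq_mul, mul_comm]

/-- the principal logarithm inverts `t ↦ e^{it}` on `|t| < π`: `log (e^{iθ}) = iθ`. [folklore] -/
theorem log_cexp_mul_I {t : ℝ} (ht : |t| < Real.pi) : Complex.log (Complex.exp (t * I)) = t * I := by
  have h := abs_lt.mp ht
  have him : ((t : ℂ) * I).im = t := by simp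
  exact Complex.log_exp (by rw [him]; exact h.1) (by rw [him]; exact h.2.le)

/-- a polynomial that interpolates the principal logarithm at the spectrum of the chart point recovers the generator:
if `p(e^{iθ_k}) = iθ_k` for all `k` then `p(exp genSU v) = genSU v`. [folklore] -/
theorem aeval_exp_eq_genSU (h : herm v = conjDiag U fun k => (θ k : ℂ)) {p : ℂ[X]}
    (hp : ∀ k, p.eval (Complex.exp (θ k * I)) = (θ k : ℂ) * I) :
    aeval (NormedSpace.exp (genSU v)) p = genSU v := by
  rw [exp_genSU_eq_conjDiag h, aeval_conjDiag, genSU_eq_conjDiag h]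
  congr 1
  funext k
  exact hp k

/-- **THE EXPONENTIAL CHART OF `SU(N)` IS ONE-TO-ONE ON THE BALL `‖v‖ ≤ S`, `S < π`** (Hilbert–Schmidt norm of the
generator; all eigenvalue moduli `≤ S < π`). [folklore] -/
theorem expPtSU_injOn {S : ℝ} (hS : S < Real.pi) : InjOn (expPtSU (N := N)) (Metric.closedBall 0 S) := by
  intro v hv w hw hvw
  rw [Metric.mem_closedBall, dist_zero_right] at hv hw
  obtain ⟨U, θ, hθ⟩ := exists_conjDiag v
  obtain ⟨V, φ, hφ⟩ := exists_conjDiag w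
  have hθπ : ∀ k, |θ k| < Real.pi := fun k => ((abs_eigen_le_norm hθ k).trans hv).trans_lt hS
  have hφπ : ∀ k, |φ k| < Real.pi := fun k => ((abs_eigen_le_norm hφ k).trans hw).trans_lt hS
  have hg : NormedSpace.exp (genSU v) = NormedSpace.exp (genSU w) := by
    rw [← coe_expPtSU, ← coe_expPtSU, hvw]
  -- the joint spectrum and the Lagrange interpolant of the principal logarithm on it
  classical
  let s : Finset ℂ := (univ.image fun k => Complex.exp (θ k * I)) ∪ univ.image fun k => Complex.exp (φ k * I)
  let p : ℂ[X] := Lagrange.interpolate s id Complex.log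
  have hp : ∀ z ∈ s, p.eval z = Complex.log z := fun z hz =>
    Lagrange.eval_interpolate_at_node (r := Complex.log) (v := id) (Set.injOn_id _) hz
  have hpθ : ∀ k, p.eval (Complex.exp (θ k * I)) = (θ k : ℂ) * I := fun k => by
    rw [hp _ (mem_union_left _ (mem_image_of_mem _ (mem_univ k))), log_cexp_mul_I (hθπ k)]
  have hpφ : ∀ k, p.eval (Complex.exp (φ k * I)) = (φ k : ℂ) * I := fun k => by
    rw [hp _ (mem_union_right _ (mem_image_of_mem _ (mem_univ k))), log_cexp_mul_I (hφπ k)]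
  have hgen : genSU v = genSU w := by
    rw [← aeval_exp_eq_genSU hθ hpθ, ← aeval_exp_eq_genSU hφ hpφ, hg]
  -- the coordinates are a linear isometry
  have hc : (coordSU v : lieSU (Fin N)) = coordSU w := Subtype.ext hgen
  exact (coordSU (N := N)).injective hc

/-- the chart about `g` is one-to-one on the ball of radius `S < π`. [folklore] -/
theorem expChartSU_injOn (g : SUN N) {S : ℝ} (hS : S < Real.pi) : InjOn (expChartSU g) (Metric.closedBall 0 S) :=
  fun _ hv _ hw hvw => expPtSU_injOn hS hv hw (mul_left_cancel (a := g) hvw)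

variable {P : Params} {j : ℕ}

/-- **THE BLOCK CHART IS ONE-TO-ONE ON THE WINDOW** `‖x‖ ≤ S`, `S < π`, about every centre `u₀`. [folklore] -/
theorem expFibreChartSU_injOn (Λ : Finset (PBond P j)) (u₀ : GaugeField P j (SUN N)) {S : ℝ} (hS : S < Real.pi) :
    InjOn (expFibreChartSU Λ u₀) (Metric.closedBall 0 S) := by
  intro x hx y hy hxy
  funext b
  have hb : expChartSU (u₀ b) (x b) = expChartSU (u₀ b) (y b) := congr_fun hxy b
  exact expChartSU_injOn (u₀ b) hS (mem_closedBall_zero_iff.mpr (norm_apply_le_of_mem_closedBall Λ hx b))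
    (mem_closedBall_zero_iff.mpr (norm_apply_le_of_mem_closedBall Λ hy b)) hb

end Injective

/-! ## §3 (v1.1) The chart restricted to the window is a CLOSED, MEASURABLE EMBEDDING -/

section Embedding

open Topology

/-- THE RESTRICTED ONE-BOND CHART `B̄_S → SU(N)`, `v ↦ exp (genSU v)`, is continuous. [folklore] -/
theorem continuous_restrict_expPtSU (S : ℝ) :
    Continuous ((Metric.closedBall (0 : ChartSU N) S).restrict (expPtSU (N := N))) :=
  continuous_expPtSU.comp continuous_subtype_val

/-- **ON THE WINDOW `‖v‖ ≤ S`, `S < π`, THE EXPONENTIAL CHART OF `SU(N)` IS A CLOSED EMBEDDING** (continuous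
injection of a compact space into a Hausdorff space): a homeomorphism onto the compact image ball `expBallSU S`, so
its inverse — the principal logarithm read in coordinates — is continuous there. [folklore] -/
theorem isClosedEmbedding_restrict_expPtSU {S : ℝ} (hS : S < Real.pi) :
    IsClosedEmbedding ((Metric.closedBall (0 : ChartSU N) S).restrict (expPtSU (N := N))) := by
  haveI : CompactSpace ↥(Metric.closedBall (0 : ChartSU N) S) :=
    isCompact_iff_compactSpace.mp (isCompact_closedBall _ _)
  exact (continuous_restrict_expPtSU S).isClosedEmbedding (injOn_iff_injective.mp (expPtSU_injOn hS))

/-- … hence a MEASURABLE EMBEDDING — the form a change-of-variables statement for (CH)₁ consumes (what is still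
missing for (CH)₁ is the measure identity itself: the Jacobian determinant `|det d exp| = |j|²` and Haar uniqueness).
[folklore] -/
theorem measurableEmbedding_restrict_expPtSU {S : ℝ} (hS : S < Real.pi) :
    MeasurableEmbedding ((Metric.closedBall (0 : ChartSU N) S).restrict (expPtSU (N := N))) :=
  (isClosedEmbedding_restrict_expPtSU hS).measurableEmbedding

/-- the image of the restricted chart is the image ball `exp(B̄_S)` (`ShellMeasureScalingSUN.expBallSU S`), written
out. [folklore] -/
theorem range_restrict_expPtSU (S : ℝ) :
    Set.range ((Metric.closedBall (0 : ChartSU N) S).restrict (expPtSU (N := N))) =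
      expPtSU '' Metric.closedBall (0 : ChartSU N) S := by
  rw [Set.range_restrict]

end Embedding

end Summit.QuantumFields.BalabanUV.T4Continuum.ShellMeasureExpInjectiveSUN

end
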